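import Summits.QuantumFields.YangMills.Theorems.PoincareLipschitzMedianCentringLocalTail
import HarnessLib

/-!
# Crux `RevelationMartingale.MeanDeviationShallowL` (stmt-QuantumFields-23133) ∕ crux `HistoryTailL` (stmt-QuantumFields-19936) — REGISTERED STUB (T)
# `stub_localTailOfMedian` OF LINE 27 «MedianCentring» BY NAME (skeleton `Cruxes/HistoryTailL/Lines/median_centring.lean`, ideator ym-r3-idea-2 g15,
# registered 2026-08-29T13:23:47Z, v1.1 re-registration 13:30Z with stub texts unchanged; this file gives the registry its by-name inhabitant)

Cell `ym3-torus` (YM ladder rung R3 = continuum SU(2) Yang–Mills on the three-torus; NOT d = 4, NOT infinite volume, NOT a mass gap, NOT the Clay problem),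
width seat `ym3-torus-px10` gen 6 (free-hands handle of the ideator, 13:26:11Z).

WHAT THIS IS.  Pure aliasing: the registered text of (T) — K1 `MesoscopicConcentrationL` → K2 `BlockLipschitzL` → (Q) the 3/4-quantile bound → the local
window tail at every depth `1 ≤ j ≤ K − 2` (the conclusion of the landed `PoincareLipschitz.local_tail` verbatim) — inhabited by
`PoincareLipschitz.MedianCentring.local_tail_median` (helper T-2: the landed height induction with the median-centred one-height step
`MedianCentring.local_step_median`, helper T-1).  WHAT THIS IS NOT.  (Q) `stub_quantileDeviation` and (M) `stub_meanOfMedian` stay OPEN; K1 and K2 are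
hypotheses; nothing of `MeanDeviationShallowL`, `MeanDeviationL`, `HistoryTailL` or the rung is proved; the Yang–Mills mass gap is NOT proved.
-/

set_option autoImplicit false

namespace Summit.QuantumFields.YangMills.Theorems.PoincareLipschitzMedianCentringLocalTailOfMedianStub

open MeasureTheory
open scoped BigOperators
open Literature.MathematicalPhysics.QuantumFieldTheory.Balaban1983to89
open Literature.MathematicalPhysics.QuantumFieldTheory.Balaban1983to89.T3ContinuumYM3Torus
open Literature.MathematicalPhysics.QuantumFieldTheory.Balaban1983to89.T3UnitScaleTilt
open Literature.MathematicalPhysics.QuantumFieldTheory.Balaban1983to89.T3UnitLawDensityEML (ℰp measurableE_ℰp)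

/-- **REGISTERED STUB (T) `stub_localTailOfMedian` OF LINE 27 «MedianCentring», BY NAME**: from the concentration crux K1, the block-Lipschitz crux K2 and
the 3/4-quantile bound (Q), the local window tail `Gibbs_K({θ(K−j) ≤ dist1(Ū^j(∂a))} ∩ G(a,j)) ≤ C·exp(−c·p(g_{K−j})²)` at all depths `1 ≤ j ≤ K − 2` for
`γ ≤ γ₁(L,b₀,p₀)` — `:=` `PoincareLipschitz.MedianCentring.local_tail_median`.
[cite: Balaban1985UV3, (3) p.256, (7) p.257 and (71) p.273; Ledoux2001, Prop. 1.3] -/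
theorem stub_localTailOfMedian :
    Summit.QuantumFields.YangMills.Theses.PoincareLipschitz.MesoscopicConcentrationL →
    Summit.QuantumFields.YangMills.Theses.PoincareLipschitz.BlockLipschitzL →
    (∀ (L : ℕ) (b₀ p₀ : ℝ), 0 < b₀ → 2 < p₀ → ∃ γ₁ : ℝ, 0 < γ₁ ∧ γ₁ ≤ 1 ∧ ∀ (F : T3Family) (γ : ℝ), F.L = L → 0 < γ → γ ≤ γ₁ →
            ∀ (K j : ℕ), 1 ≤ j → j + 2 ≤ K → ∀ a : Plaq (F.P K) j,
              3 / 4 ≤ (gibbsK F ℰp γ K).real {U : GaugeField (F.P K) 0 (Matrix.specialUnitaryGroup (Fin 2) ℂ) | GaugeGroup.dist1 (GaugeField.plaqHol (Averaging.iter (fun i' => BlockAveraging.blockAvg (P := F.P K) (j := i') ℰp) j U) a) ≤ θBal F.L γ b₀ p₀ (K - j) / 8}) →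
    ∀ (L : ℕ) (b₀ p₀ : ℝ), 0 < b₀ → 2 < p₀ → ∃ (γ₁ C c : ℝ), 0 < γ₁ ∧ γ₁ ≤ 1 ∧ 0 ≤ C ∧ 0 < c ∧ ∀ (F : T3Family) (γ : ℝ), F.L = L → 0 < γ → γ ≤ γ₁ →
          ∀ (K j : ℕ), 1 ≤ j → j + 2 ≤ K → ∀ a : Plaq (F.P K) j,
            (gibbsK F ℰp γ K).real ({U : GaugeField (F.P K) 0 (Matrix.specialUnitaryGroup (Fin 2) ℂ) | θBal F.L γ b₀ p₀ (K - j) ≤ GaugeGroup.dist1 (GaugeField.plaqHol (Averaging.iter (fun i' => BlockAveraging.blockAvg (P := F.P K) (j := i') ℰp) j U) a)} ∩ {U : GaugeField (F.P K) 0 (Matrix.specialUnitaryGroup (Fin 2) ℂ) | (∀ (i : ℕ) (q : Plaq (F.P K) i), i < j → Site.tdist (fun k => ((((q.src k).val * F.L ^ i : ℕ)) : ZMod ((F.P K).sitesPerDir 0))) (fun k => ((((a.src k).val * F.L ^ j : ℕ)) : ZMod ((F.P K).sitesPerDir 0))) + 64 * F.L ^ i ≤ 64 * F.L ^ j → GaugeGroup.dist1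 (GaugeField.plaqHol (Averaging.iter (fun i' => BlockAveraging.blockAvg (P := F.P K) (j := i') ℰp) i U) q) < θBal F.L γ b₀ p₀ (K - i))}) ≤
              C * Real.exp (-(c * B10.pFun b₀ p₀ (Real.sqrt (γ * ((F.L : ℝ)⁻¹) ^ (K - j))) ^ 2)) :=
  fun hC hLip hQ L _b₀ _p₀ hb₀ hp₀ =>
    Summit.QuantumFields.YangMills.Theorems.PoincareLipschitz.MedianCentring.local_tail_median hC hLip hQ L hb₀ hp₀

end Summit.QuantumFields.YangMills.Theorems.PoincareLipschitzMedianCentringLocalTailOfMedianStub
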